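import Literature.Analysis.UnboundedOperators.LinearizedBoltzmannBurnettProofs
import Literature.Probability.Distributions.GaussianMoments
import HarnessLib

/-!
# Orthogonality of the heat-flux Burnett function `B_i` to the collision invariants: discharge

Sibling proof file of `LinearizedBoltzmann.lean` (D-0014: named facts `def X : Prop` are
discharged as `theorem X_holds : X`). It discharges

* `Literature.Analysis.UnboundedOperators.burnettB_orthogonal_collisionInvariants_holds :
  burnettB_orthogonal_collisionInvariants` — for every orthonormal basis `b` of the velocity space
  `E`, every `i`, and every collision invariant `φ ∈ span {1, ⟪·, e⟫, |·|²}`,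
  `⟪B_i, φ⟫_M = ∫ B_i φ dM = 0`, where `B_i(v) = ½ vᵢ (|v|² - (d + 2))` is the heat-flux Burnett
  function (`d = dim E`) and `M dv = stdGaussian E` the normalised Maxwellian.

Sources. Bardos–Golse–Levermore, *Fluid dynamic limits of kinetic equations I*, J. Stat. Phys.
63 (1991), §3, (21)–(22), p. 329 (there the heat flux is called `A(V) = (½|V|² − 5/2) V`,
`D = 3`): *"By symmetry, the functions `Aᵢ` and `B_{ij}` are orthogonal to the kernel of `L`"*,
the kernel being `span {1, v₁, v₂, v₃, |v|²}`; in general dimension `D` with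
`B(v) = ½|v|² v − ((D+2)/2) v`: Levermore–Masmoudi, Arch. Ration. Mech. Anal. 196 (2010), §4.3,
(4.7)–(4.8), p. 18: *"each entry of `A` and `B` is in `Null(L)^⊥`"*; also Bardos–Golse–Levermore,
CPAM 46 (1993), §2 (the citation carried by the fact) and Golse–Saint-Raymond, Invent. Math. 155
(2004), Prop. 1.4/(1.42), p. 93.

Proof. Write `φ(v) = a + ⟪c, v⟫ + e|v|²` (`mem_collisionInvariants_iff`) and split
`c = c' + ⟪b i, c⟫ b i` with `c' ⊥ b i`.
* `(a + e|v|²) B_i(v)` is odd under `v ↦ -v`, hence has Maxwellian integral `0`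
  (`integral_stdGaussian_eq_zero_of_odd` of `LinearizedBoltzmannBurnettProofs.lean`: the Gaussian
  is invariant under linear isometries, Mathlib `stdGaussian_map`);
* `B_i(v) ⟪c', v⟫` is odd under the reflection fixing `b i` and negating `(b i)ᗮ`
  (`Submodule.reflection (ℝ ∙ b i)`);
* the remaining term is the genuine Gaussian moment identity
  `∫ vᵢ² (|v|² − (d + 2)) dM = ∑ⱼ ∫ vᵢ² vⱼ² dM − (d + 2) ∫ vᵢ² dM = (3 + (d − 1)) − (d + 2) = 0`,
  computed in the coordinates of `b` (Mathlib `stdGaussian_eq_map_pi_orthonormalBasis`: `M dv` is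
  the image of `⊗ᵢ 𝒩(0,1)`) from the one-dimensional moments `𝔼 X² = 1`, `𝔼 X⁴ = 3`
  (`Literature.Probability.Distributions.integral_pow_even_gaussianReal_one`) and Fubini
  (`MeasureTheory.integral_fintype_prod_eq_prod`);
* splitting the integral uses integrability of temperate-growth functions against `M dv`
  (`integrable_stdGaussian_of_hasTemperateGrowth` of `LinearizedBoltzmannPositivityProofs.lean`).
No hypothesis on the dimension is needed. The mathematical statement is
`maxwellianInner_burnettB_eq_zero` (Borel σ-algebra on `E`); the fact as vendored quantifies over
an arbitrary `[MeasurableSpace E]`, and holds verbatim there too because `stdGaussian E` is *by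
definition* a push-forward of the product Gaussian: the integral is then either the same
coordinate integral (`integral_pi_burnettB_mul_eq_zero`) or Bochner's junk value `0`.

Mathlib anchors: `ProbabilityTheory.stdGaussian_eq_map_pi_orthonormalBasis`,
`MeasureTheory.integral_fintype_prod_eq_prod`, `MeasureTheory.integral_comp_eval`,
`Submodule.reflection_singleton_apply`, `LinearIsometryEquiv.neg`, `MeasureTheory.integral_map`,
`MeasureTheory.integral_non_aestronglyMeasurable`, `MeasureTheory.Measure.map_of_not_aemeasurable`.
-/

open MeasureTheory ProbabilityTheory Module
open scoped InnerProductSpace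

namespace Literature.Analysis.UnboundedOperators

noncomputable section

variable {E : Type*} [NormedAddCommGroup E] [InnerProductSpace ℝ E]

/-! ### Orthonormal coordinates -/

section Basis

variable {ι : Type*} [Fintype ι]

/-- `⟪b j, ∑ₖ xₖ bₖ⟫ = xⱼ` for an orthonormal basis `b`. [folklore] -/
theorem inner_basis_sum_smul (b : OrthonormalBasis ι ℝ E) (x : ι → ℝ) (j : ι) :
    ⟪b j, ∑ k, x k • b k⟫_ℝ = x j := by
  classical
  rw [inner_sum]
  simp_rw [inner_smul_right, orthonormal_iff_ite.1 b.orthonormal]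
  simp

/-- `‖∑ₖ xₖ bₖ‖² = ∑ⱼ xⱼ²` for an orthonormal basis `b`. [folklore] -/
theorem norm_sq_basis_sum_smul (b : OrthonormalBasis ι ℝ E) (x : ι → ℝ) :
    ‖∑ k, x k • b k‖ ^ 2 = ∑ j, x j ^ 2 := by
  rw [← b.repr.norm_map, EuclideanSpace.real_norm_sq_eq]
  simp_rw [OrthonormalBasis.repr_apply_apply, inner_basis_sum_smul]

/-- `B_i` written with inner products: `B_i(v) = ⟪b i, v⟫ (|v|² - (d + 2)) / 2`. [folklore] -/
theorem burnettB_apply (b : OrthonormalBasis ι ℝ E) (i : ι) (v : E) :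
    burnettB b i v = ⟪b i, v⟫_ℝ * (‖v‖ ^ 2 - (finrank ℝ E + 2)) / 2 := by
  simp only [burnettB, OrthonormalBasis.repr_apply_apply]

/-- `B_i` is odd. [folklore] -/
theorem burnettB_neg (b : OrthonormalBasis ι ℝ E) (i : ι) (v : E) :
    burnettB b i (-v) = -burnettB b i v := by
  simp only [burnettB_apply, inner_neg_right, norm_neg]
  ring

/-- `B_i` is invariant under the reflection fixing `b i` and negating `(b i)ᗮ`. [folklore] -/
theorem burnettB_reflection_singleton (b : OrthonormalBasis ι ℝ E) (i : ι) (v : E) :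
    burnettB b i ((ℝ ∙ b i).reflection v) = burnettB b i v := by
  have h1 : ‖b i‖ = 1 := b.orthonormal.1 i
  have h2 : ⟪b i, (ℝ ∙ b i).reflection v⟫_ℝ = ⟪b i, v⟫_ℝ := by
    rw [Submodule.reflection_singleton_apply]
    simp only [inner_sub_right, inner_smul_right, real_inner_self_eq_norm_sq, h1, two_smul,
      inner_add_right]
    norm_num
  simp only [burnettB_apply, LinearIsometryEquiv.norm_map, h2]

/-- A vector orthogonal to `b i` pairs antisymmetrically with the reflection fixing `b i`:
`⟪c, R v⟫ = -⟪c, v⟫` for `c ⊥ b i`. [folklore] -/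
theorem inner_reflection_singleton_of_inner_eq_zero (b : OrthonormalBasis ι ℝ E) (i : ι)
    {c : E} (hc : ⟪b i, c⟫_ℝ = 0) (v : E) : ⟪c, (ℝ ∙ b i).reflection v⟫_ℝ = -⟪c, v⟫_ℝ := by
  rw [Submodule.reflection_singleton_apply]
  have hc' : ⟪c, b i⟫_ℝ = 0 := by rw [real_inner_comm]; exact hc
  simp [inner_sub_right, inner_add_right, inner_smul_right, two_smul, hc']

/-- `B_i` has temperate growth (`burnettB_mem_temperateGrowth`, restated with
`Function.HasTemperateGrowth` for `fun_prop`). [folklore] -/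
theorem hasTemperateGrowth_burnettB (b : OrthonormalBasis ι ℝ E) (i : ι) :
    Function.HasTemperateGrowth (burnettB b i) :=
  burnettB_mem_temperateGrowth b i

end Basis

/-! ### Moments of the product Gaussian `⊗ᵢ 𝒩(0,1)` on `ι → ℝ` up to order four -/

section PiMoments

variable {ι : Type*} [Fintype ι]

/-- Moments of one coordinate under the product Gaussian are the one-dimensional moments
(`MeasureTheory.integral_comp_eval`). [folklore] -/
theorem integral_coord_pow_pi_gaussianReal (i : ι) (n : ℕ) :
    ∫ x : ι → ℝ, x i ^ n ∂(Measure.pi fun _ : ι => gaussianReal 0 1) =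
      ∫ y, y ^ n ∂gaussianReal 0 1 :=
  integral_comp_eval (μ := fun _ : ι => gaussianReal 0 1) (i := i) (f := fun y : ℝ => y ^ n)
    (continuous_pow n).aestronglyMeasurable

/-- Powers of a coordinate are integrable under the product Gaussian. [folklore] -/
theorem integrable_coord_pow_pi_gaussianReal (i : ι) (n : ℕ) :
    Integrable (fun x : ι → ℝ => x i ^ n) (Measure.pi fun _ : ι => gaussianReal 0 1) :=
  integrable_comp_eval (μ := fun _ : ι => gaussianReal 0 1) (i := i) (f := fun y : ℝ => y ^ n)
    (Literature.Probability.Distributions.integrable_pow_gaussianReal 0 1 n)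

/-- `∫ xᵢ² d(⊗𝒩(0,1)) = 1` (`𝔼 X² = 1‼ = 1`). [folklore] -/
theorem integral_coord_sq_pi_gaussianReal (i : ι) :
    ∫ x : ι → ℝ, x i ^ 2 ∂(Measure.pi fun _ : ι => gaussianReal 0 1) = 1 := by
  rw [integral_coord_pow_pi_gaussianReal]
  have h := Literature.Probability.Distributions.integral_pow_even_gaussianReal_one 1
  norm_num [Nat.doubleFactorial] at h
  exact h

/-- `∫ xᵢ⁴ d(⊗𝒩(0,1)) = 3` (`𝔼 X⁴ = 3‼ = 3`). [folklore] -/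
theorem integral_coord_pow_four_pi_gaussianReal (i : ι) :
    ∫ x : ι → ℝ, x i ^ 4 ∂(Measure.pi fun _ : ι => gaussianReal 0 1) = 3 := by
  rw [integral_coord_pow_pi_gaussianReal]
  have h := Literature.Probability.Distributions.integral_pow_even_gaussianReal_one 2
  norm_num [Nat.doubleFactorial] at h
  exact h

/-- The square of a coordinate is in `L²` of the product Gaussian. [folklore] -/
theorem memLp_two_coord_sq_pi_gaussianReal (i : ι) :
    MemLp (fun x : ι → ℝ => x i ^ 2) 2 (Measure.pi fun _ : ι => gaussianReal 0 1) := by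
  rw [memLp_two_iff_integrable_sq
    ((measurable_pi_apply i).pow_const 2).aestronglyMeasurable]
  simpa [← pow_mul] using integrable_coord_pow_pi_gaussianReal i 4

/-- `xᵢ² xⱼ²` is integrable under the product Gaussian. [folklore] -/
theorem integrable_coord_sq_mul_coord_sq_pi_gaussianReal (i j : ι) :
    Integrable (fun x : ι → ℝ => x i ^ 2 * x j ^ 2) (Measure.pi fun _ : ι => gaussianReal 0 1) :=
  (memLp_two_coord_sq_pi_gaussianReal i).integrable_mul (memLp_two_coord_sq_pi_gaussianReal j)

/-- Mixed fourth moments of the product Gaussian: `∫ xᵢ² xⱼ² d(⊗𝒩(0,1)) = 1 + 2 δᵢⱼ`, i.e. `3`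
on the diagonal and `1 = 1 · 1` off it (Fubini; the simplest instance of Isserlis'/Wick's
formula). [folklore] -/
theorem integral_coord_sq_mul_coord_sq_pi_gaussianReal [DecidableEq ι] (i j : ι) :
    ∫ x : ι → ℝ, x i ^ 2 * x j ^ 2 ∂(Measure.pi fun _ : ι => gaussianReal 0 1) =
      1 + if i = j then 2 else 0 := by
  by_cases hij : i = j
  · subst hij
    rw [if_pos rfl]
    have h : ∀ x : ι → ℝ, x i ^ 2 * x i ^ 2 = x i ^ 4 := fun x => by ring
    simp_rw [h, integral_coord_pow_four_pi_gaussianReal]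
    norm_num
  · rw [if_neg hij, add_zero]
    set f : ι → ℝ → ℝ := fun k t => (if k = i then t ^ 2 else 1) * (if k = j then t ^ 2 else 1)
      with hfdef
    have hf : ∀ x : ι → ℝ, x i ^ 2 * x j ^ 2 = ∏ k, f k (x k) := by
      intro x
      simp only [hfdef]
      rw [Finset.prod_mul_distrib]
      simp
    simp_rw [hf]
    rw [integral_fintype_prod_eq_prod]
    refine Finset.prod_eq_one fun k _ => ?_
    have h2 : ∫ t, t ^ 2 ∂gaussianReal 0 1 = 1 := by
      have h := Literature.Probability.Distributions.integral_pow_even_gaussianReal_one 1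
      norm_num [Nat.doubleFactorial] at h
      exact h
    by_cases hki : k = i
    · subst hki
      simp [hfdef, hij, h2]
    · by_cases hkj : k = j
      · subst hkj
        simp [hfdef, hki, h2]
      · simp [hfdef, hki, hkj]

end PiMoments

/-! ### The Gaussian moment identity and the discharge -/

variable [FiniteDimensional ℝ E] [MeasurableSpace E] [BorelSpace E]

section Burnett

variable {ι : Type*} [Fintype ι]

/-- The Gaussian moment identity behind `B_i ⊥ vᵢ`: `∫ vᵢ² (|v|² - (d + 2)) dM = 0`, i.e.
`∫ vᵢ² |v|² dM = ∑ⱼ ∫ vᵢ² vⱼ² dM = 3 + (d − 1) = d + 2` and `∫ vᵢ² dM = 1`, computed in the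
coordinates of `b` (`stdGaussian_eq_map_pi_orthonormalBasis`). [folklore] -/
theorem integral_inner_sq_mul_norm_sq_sub (b : OrthonormalBasis ι ℝ E) (i : ι) :
    ∫ v, ⟪b i, v⟫_ℝ ^ 2 * (‖v‖ ^ 2 - (finrank ℝ E + 2)) ∂stdGaussian E = 0 := by
  classical
  rw [stdGaussian_eq_map_pi_orthonormalBasis b,
    integral_map (Measurable.aemeasurable (by fun_prop))
      (Continuous.aestronglyMeasurable (by fun_prop))]
  simp_rw [inner_basis_sum_smul, norm_sq_basis_sum_smul]
  have hd : (finrank ℝ E : ℝ) = Fintype.card ι := by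
    rw [finrank_eq_card_basis b.toBasis]
  have hexp : ∀ x : ι → ℝ, x i ^ 2 * (∑ j, x j ^ 2 - ((finrank ℝ E : ℝ) + 2)) =
      ∑ j, x i ^ 2 * x j ^ 2 - ((finrank ℝ E : ℝ) + 2) * x i ^ 2 := fun x => by
    rw [mul_sub, Finset.mul_sum]; ring
  simp_rw [hexp]
  rw [integral_sub (integrable_finsetSum _ fun j _ =>
        integrable_coord_sq_mul_coord_sq_pi_gaussianReal i j)
      ((integrable_coord_pow_pi_gaussianReal i 2).const_mul _),
    integral_finsetSum _ fun j _ => integrable_coord_sq_mul_coord_sq_pi_gaussianReal i j,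
    integral_const_mul, integral_coord_sq_pi_gaussianReal]
  simp_rw [integral_coord_sq_mul_coord_sq_pi_gaussianReal]
  rw [Finset.sum_add_distrib, Finset.sum_ite_eq]
  simp [hd]

/-- **`B_i ⊥_M` collision invariants** (Borel case): `∫ B_i φ dM = 0` for
`φ = a + ⟪c, ·⟫ + e|·|²`. The constant and `|v|²` parts pair with the odd function `B_i` to an odd
integrand; the part of `c` orthogonal to `b i` changes sign under the reflection fixing `b i`; the
remaining Gaussian moment is `∫ vᵢ² (|v|² - (d+2)) dM = 0` (`integral_inner_sq_mul_norm_sq_sub`).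
(BGL 1991 §3 (21)–(22) p. 329; Levermore–Masmoudi 2010 §4.3 (4.7)–(4.8) p. 18; BGL 1993 §2.)
[cite: BGLFluidDynamicLimitsI1991, §3 (21)–(22) p. 329]
[cite: LevermoreMasmoudi2010, §4.3 (4.7)–(4.8) p. 18] -/
theorem maxwellianInner_burnettB_eq_zero (b : OrthonormalBasis ι ℝ E) (i : ι) {φ : E → ℝ}
    (hφ : φ ∈ collisionInvariants E) : maxwellianInner (burnettB b i) φ = 0 := by
  obtain ⟨a, e, c, rfl⟩ := mem_collisionInvariants_iff.1 hφ
  unfold maxwellianInner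
  have hB := hasTemperateGrowth_burnettB b i
  have h1 : ‖b i‖ = 1 := b.orthonormal.1 i
  -- split `c` into its components along `b i` and orthogonal to it
  set t : ℝ := ⟪b i, c⟫_ℝ with ht
  set c' : E := c - t • b i with hc'
  have hc'orth : ⟪b i, c'⟫_ℝ = 0 := by
    simp [hc', inner_sub_right, inner_smul_right, h1, ht]
  have hsplit : ∀ v, burnettB b i v * (a + ⟪c, v⟫_ℝ + e * ‖v‖ ^ 2) =
      (a * burnettB b i v + e * (burnettB b i v * ‖v‖ ^ 2)) + burnettB b i v * ⟪c', v⟫_ℝ +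
        t * (burnettB b i v * ⟪b i, v⟫_ℝ) := by
    intro v
    simp only [hc', inner_sub_left, inner_smul_left, RCLike.conj_to_real]
    ring
  simp_rw [hsplit]
  -- integrability of the three pieces (polynomials: temperate growth)
  have hI1 : Integrable (fun v => a * burnettB b i v + e * (burnettB b i v * ‖v‖ ^ 2))
      (stdGaussian E) :=
    integrable_stdGaussian_of_hasTemperateGrowth (by fun_prop)
  have hI2 : Integrable (fun v => burnettB b i v * ⟪c', v⟫_ℝ) (stdGaussian E) :=
    integrable_stdGaussian_of_hasTemperateGrowth (by fun_prop)
  have hI3 : Integrable (fun v => t * (burnettB b i v * ⟪b i, v⟫_ℝ)) (stdGaussian E) :=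
    integrable_stdGaussian_of_hasTemperateGrowth (by fun_prop)
  have hI12 : Integrable (fun v => a * burnettB b i v + e * (burnettB b i v * ‖v‖ ^ 2) +
      burnettB b i v * ⟪c', v⟫_ℝ) (stdGaussian E) := hI1.add hI2
  rw [integral_add hI12 hI3, integral_add hI1 hI2, integral_const_mul]
  -- (1) odd part: `v ↦ -v`
  have hodd : ∫ v, (a * burnettB b i v + e * (burnettB b i v * ‖v‖ ^ 2)) ∂stdGaussian E = 0 := by
    refine integral_stdGaussian_eq_zero_of_odd (LinearIsometryEquiv.neg ℝ) fun v => ?_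
    rw [LinearIsometryEquiv.coe_neg, burnettB_neg, norm_neg]
    ring
  -- (2) the part orthogonal to `b i`: antisymmetric under the reflection fixing `b i`
  have hrefl : ∫ v, burnettB b i v * ⟪c', v⟫_ℝ ∂stdGaussian E = 0 := by
    refine integral_stdGaussian_eq_zero_of_odd (ℝ ∙ b i).reflection fun v => ?_
    rw [burnettB_reflection_singleton, inner_reflection_singleton_of_inner_eq_zero b i hc'orth]
    ring
  -- (3) the genuine moment computation
  have hmom : ∫ v, burnettB b i v * ⟪b i, v⟫_ℝ ∂stdGaussian E = 0 := by
    have h : ∀ v, burnettB b i v * ⟪b i, v⟫_ℝ =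
        (1 / 2 : ℝ) * (⟪b i, v⟫_ℝ ^ 2 * (‖v‖ ^ 2 - (finrank ℝ E + 2))) := fun v => by
      rw [burnettB_apply]
      ring
    simp_rw [h]
    rw [integral_const_mul, integral_inner_sq_mul_norm_sq_sub b i, mul_zero]
  rw [hodd, hrefl, hmom]
  simp

omit [MeasurableSpace E] [BorelSpace E] in
/-- Coordinate form of `maxwellianInner_burnettB_eq_zero`, free of any measurable structure on
`E`: `∫ (B_i φ)(∑ₖ xₖ sₖ) d(⊗ₖ 𝒩(0,1))(x) = 0` for every orthonormal basis `s` of `E` (`M dv` is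
the image of the product Gaussian, Mathlib `stdGaussian_eq_map_pi_orthonormalBasis`).
[folklore] -/
theorem integral_pi_burnettB_mul_eq_zero (b : OrthonormalBasis ι ℝ E) (i : ι) {φ : E → ℝ}
    (hφ : φ ∈ collisionInvariants E) {κ : Type*} [Fintype κ] (s : OrthonormalBasis κ ℝ E) :
    ∫ x, burnettB b i (∑ k, x k • s k) * φ (∑ k, x k • s k)
      ∂(Measure.pi fun _ : κ => gaussianReal 0 1) = 0 := by
  borelize E
  have hφc : Continuous φ :=
    (show Function.HasTemperateGrowth φ from collisionInvariants_le_temperateGrowth hφ).1.continuous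
  have hc : Continuous fun v => burnettB b i v * φ v :=
    (hasTemperateGrowth_burnettB b i).1.continuous.mul hφc
  have h := maxwellianInner_burnettB_eq_zero b i hφ
  unfold maxwellianInner at h
  rwa [stdGaussian_eq_map_pi_orthonormalBasis s,
    integral_map (Measurable.aemeasurable (by fun_prop)) hc.aestronglyMeasurable] at h

omit [BorelSpace E] in
/-- **Discharge** of `burnettB_orthogonal_collisionInvariants`: the heat-flux Burnett function
`B_i(v) = ½ vᵢ (|v|² - (d + 2))` is `M`-orthogonal to every collision invariant,
`∫ B_i φ dM = 0` for `φ ∈ span {1, ⟪·, e⟫, |·|²}` (Bardos–Golse–Levermore 1991, §3 (21)–(22),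
p. 329: *"By symmetry, the functions `Aᵢ` [`= (½|V|² − 5/2)Vᵢ`] … are orthogonal to the kernel
of `L`"*; in dimension `D`, Levermore–Masmoudi 2010, §4.3 (4.7)–(4.8), p. 18; Bardos–Golse–
Levermore 1993 §2). The content is `maxwellianInner_burnettB_eq_zero` (Borel σ-algebra); no
`BorelSpace` hypothesis is needed for the fact as stated, since `stdGaussian E` is by definition
a push-forward of the product Gaussian: for an arbitrary σ-algebra on `E` the integral is either
the same coordinate integral (`integral_pi_burnettB_mul_eq_zero`) or Bochner's junk value `0`.
[cite: BardosGolseLevermore1993, §2] [cite: BGLFluidDynamicLimitsI1991, §3 (21)–(22) p. 329]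
[cite: LevermoreMasmoudi2010, §4.3 (4.7)–(4.8) p. 18] -/
theorem burnettB_orthogonal_collisionInvariants_holds :
    burnettB_orthogonal_collisionInvariants (E := E) (ι := ι) := by
  intro b i φ hφ
  unfold maxwellianInner stdGaussian
  set Φ : (Fin (finrank ℝ E) → ℝ) → E := fun x => ∑ j, x j • stdOrthonormalBasis ℝ E j with hΦ
  by_cases hm : AEMeasurable Φ (Measure.pi fun _ : Fin (finrank ℝ E) => gaussianReal 0 1)
  · by_cases hF : AEStronglyMeasurable (fun v => burnettB b i v * φ v)
        ((Measure.pi fun _ : Fin (finrank ℝ E) => gaussianReal 0 1).map Φ)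
    · rw [integral_map hm hF]
      exact integral_pi_burnettB_mul_eq_zero b i hφ (stdOrthonormalBasis ℝ E)
    · exact integral_non_aestronglyMeasurable hF
  · rw [Measure.map_of_not_aemeasurable hm, integral_zero_measure]

end Burnett

end

end Literature.Analysis.UnboundedOperators
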